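import Literature.NumberTheory.EllipticCurves.BDPAnticyclotomicPAdicLFunction
import Literature.NumberTheory.EllipticCurves.Newforms
import Literature.NumberTheory.Automorphic.AdeleBaseChange
import HarnessLib

/-!
# Hsieh's anticyclotomic Rankin–Selberg `p`-adic `L`-function `𝒫_Σ(π, λ)² ∈ Z̄_p⟦Γ⁻⟧`
# (Hsieh, Doc. Math. 19 (2014): Thm. A p. 712 = Thm. 5.7 p. 754 in print; Thm. 1 = Thm. 5.6 in the
# e-print arXiv:1112.1580 from which it was typed), typed IN HSIEH'S FRAME at `F = ℚ`, weight `2`,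
# for the CM type `Σ = {σ̄}` and in the twisted variable `χ = λφ`

Trunk T-NT-EC (`Literature/NumberTheory/EllipticCurves`); companion of
`BDPAnticyclotomicPAdicLFunction.lean` (Castella 2018, Thm. 3.1: the receptacle `R₀⟦T⟧`, the
predicate `IsBDPLFunction`, the fact `castella2018_exists_isBDPLFunction` carrying `5 ≤ p`,
`Squarefree N`). Cell `b2b-bsdres`, team x11b3 (X11b at `p = 3`), sub-target S18 (OWNERS R7-22 /
R7-27 / R7-36 / R7-37; fact pen + proposer = seat lit1 (locator rows `cells/x11b3/LIT-TABLE.md` L54,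
L56, L57); dictionary reviewer = route planner 2 (`D3-DICTIONARY.md`, `gen6/D3EPS.md`); second reader
= route planner 1 (S-a…S-f); statement SHAPE = the S18(b) hand's consumer-shaped draft v2 (seat x11b3-p7,
OWNERS R7-41 inputs of record (Q1)–(Q3)), AUDITED symbol by symbol against the page and PROPOSED by the
fact pen (seat x11b3-lit1, LIT-TABLE L57 = the binder/display ledger of this file)).
HONEST FRAMING: ONE named fact (`def … : Prop`, cited, nothing proved) + two definitions + API; the
statement is a CONSEQUENCE of the printed theorem by the SPECIALISATIONS (S1)–(S8), WEAKENINGS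
(W1)–(W4) and EVALUATIONS (E1)–(E2) listed below, each with a locator; nothing is asserted about the
`R₀ = 𝒪(ℚ̂_p^ur)`-rationality of the element (at `p ∣ N` that is NOT in print below `p = 5`: it is the
consumer's named residual `Three.HsiehFrameResidualAt₃`, Summits-side). Valid at every ODD `p` split
in `K`, INCLUDING `p ‖ N` (`π_p` Steinberg): Hsieh's level datum is "`𝔑` the prime-to-`p` conductor
of `π_K ⊗ λ`" [p. 4 l. 1] and (ord) is a condition on the CM type only [p. 3 ll. 24–28] (lit1 L54/L56).

## The statement as typed, from the e-print (Hsieh, *Special values of anticyclotomic Rankin–Selberg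
## L-functions*, arXiv:1112.1580, pp. 3–4; Thm. 1 = Thm. 5.6 (p. 23); published as Doc. Math. 19 (2014)
## 709–767, where it is Thm. A (p. 712) = Thm. 5.7 (p. 754) — see ERRATUM E-G131-1 below for the
## differences of the printed version; every `[p. … l. …]` locator in this module is an e-print locator)

Setting [p. 3]: "`𝓕` totally real, `𝓚` a totally imaginary quadratic extension of `𝓕` … `π` an
irreducible cuspidal automorphic representation of `GL_2(𝔸_𝓕)` with unitary central character `ω` …
`λ : 𝔸_𝓚^×/𝓚^× → ℂ^×` a unitary Hecke character such that `λ|_{𝔸^×} = ω⁻¹`" [ll. 4–5]; "Fix a CM-type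
`Σ` of `𝓚` … `Σ` induces `𝓚 ⊗_ℚ ℝ ≅ ℂ^Σ`" [ll. 7–9]; "`χ` of infinity type `(k₁, k₂)` … if `χ_∞(z) =
z^{k₁−k₂}(z z̄)^{k₂}`" [ll. 12–13]; "`𝔫 = 𝔫⁺𝔫⁻` the conductor of `π`", `𝔫⁻` "divisible by primes inert
or ramified in `𝓚`"; "**Hypothesis 1.** The local root number `ε*(π_{𝓚_v}, λ_v) = +1` for each
`v ∣ 𝔫⁻`" [l. 22]; "`π` has infinity type `κ ∈ ℤ_{>0}[Σ]` and `λ` has infinity type `(κ/2, −κ/2)`"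
[l. 20]; "Let `p` be an odd rational prime. Fix … `ι : ℂ ≅ ℂ_p` … (ord) `Σ` is `p`-ordinary … `Σ_p` and
its complex conjugation `Σ̄_p` give a full partition of the set of places of `𝓚` [above `p`]"
[ll. 24–28]; "`Γ⁻ = Gal(𝓚⁻_{p^∞}/𝓚)` [the anticyclotomic `ℤ_p^{[𝓕:ℚ]}`-extension], `Λ = Z̄_p⟦Γ⁻⟧`"
(`Z̄_p` = "the completion of `Z̄` in `ℚ̄_p`" [p. 7 l. 36]); `rec_𝓚` "geometrically normalized"; "To each
locally algebraic character `φ̂ : Γ⁻ → ℂ_p^×` of weight `(m, −m)`, we can associate a Hecke character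
`φ` of infinity type `(m, −m)`: `φ(a) := ι⁻¹(φ̂(rec_𝓚(a)) a_p^{−m} ā_p^{m}) a_∞^{m} ā_∞^{−m}` … `𝔛` the
set of … locally algebraic characters on `Γ⁻` of weight `(m, −m)` with `m ∈ ℤ_{≥0}[Σ]`" [ll. 28–32].
[p. 4]: "`𝔑` the prime-to-`p` conductor of `π_𝓚 ⊗ λ` … `𝔑⁺ = ℭℭ̄` … `δ ∈ 𝓚` such that `δ̄ = −δ`,
`Im σ(δ) > 0`, the polarization ideal `𝔠(𝒪_𝓚) := 𝒟_𝓕⁻¹(2δ𝒟_{𝓚/𝓕})` is prime to `p𝔑𝔑̄`" [ll. 1–7];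
periods `(Ω_∞, Ω_p) ∈ (ℂ^×)^Σ × (Z̄_p^×)^Σ` [p. 23 ll. 63–66]; "`E_{Σ_p}(π, χ) := ∏_{w ∈ Σ_p, v = ww̄}
ε(½, π_v ⊗ χ_w̄, ψ_v) · L(½, π_v ⊗ χ_w̄)^{−2} · ω⁻¹χ_w^{−2}(−2δ)`" [ll. 9–11]. **Theorem 1.** "In
addition to (ord) and Hypothesis 1, we further assume that (sf) `𝔫⁻` is square-free. Then there
exists an element `𝒫_Σ(π, λ) ∈ Λ` such that for every `φ̂ ∈ 𝔛` of weight `(m, −m)`, we have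
`φ̂(𝒫_Σ(π,λ)²)/Ω_p^{2(κ+2m)} = [𝒪_𝓚^× : 𝒪_𝓕^×]² · Γ_Σ(κ+m)Γ_Σ(m+1)/((Im δ)^{κ+2m}(4π)^{κ+2m+1·Σ})
· E_{Σ_p}(π, λφ) · L(½, π_𝓚 ⊗ λφ)/Ω_𝓚^{2(κ+2m)} · φ(ℭ) C(π, λ)`, where `Ω_𝓚 = (2πi)⁻¹Ω_∞` and
`C(π, λ) ∈ Z̄_{(p)}^×` is an explicit unit independent of `φ`, consisting of a product of local
epsilon factors outside `p`" [ll. 13–18].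

ERRATUM E-G131-1 (lit GEN 131, 2026-08-25; read of the PRINTED version — Doc. Math. 19 (2014) 709–767,
PDF sha16 `a662df673725f6ab` — against the e-print; record `HOME/b2b-bsdres-lit/g131/hsieh/
HSIEH2014-PRINT-READ.md`; locators only, nothing below the module docstring changes meaning). In print:
"Hypothesis 1" is "Hypothesis A" (p. 710); Thm. 1 / Thm. 2 are "Theorem A" (p. 712) / "Theorem B"
(p. 713); Thm. 5.6 is Thm. 5.7 (p. 754) and Thm. 2's body is Thm. 6.2 (p. 757); "Let `p` be an odd
rational prime", (ord), and "`𝔑` the prime-to-`p` conductor of `π_𝓚 ⊗ λ` … `𝔑⁺ = 𝔉𝔉̄`" are on p. 711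
(print writes `𝔉` for `ℭ`); the multiplier is printed "(0.2) `e_{Σ_p}(π, χ) := ∏_{𝔓 ∈ Σ_p, 𝔭 = 𝔓𝔓̄}
ε(½, π_𝔭 ⊗ χ_𝔓̄, ψ_𝔭) L(½, π_𝔭 ⊗ χ_𝔓̄)⁻² χ_𝔓̄⁻²(−2δ)`" (p. 711); and Theorem A's display reads
"`φ̂(ℒ_{Σ_p}(π,λ)²)/Ω_p^{2(k+2m)} = Γ_Σ(k+m)Γ_Σ(m+1)/((Im δ)^{k+2m}(4π)^{k+2m+1·Σ}) · e_{Σ_p}(π, λφ) ·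
L(½, π_𝓚 ⊗ λφ)/Ω_𝓚^{2(k+2m)} × [𝒪_𝓚^× : 𝒪_𝓕^×]² · φ(𝔉⁻¹)`" (p. 712) — with NO constant `C(π, λ)`
(in print the unit is normalised into `ℒ_{Σ_p}(π, λ)`: proof of Thm. 5.7, p. 755). Print's definition
(5.10) of `L^{alg}(½, π_𝓚 ⊗ χ)` (p. 754) misprints the numerator as `Γ_Σ(m)Γ_Σ(k+m)`; the factor of the
theorem is `Γ_Σ(k+m)Γ_Σ(m+1)` — Thm. A p. 712, Thm. C p. 713, Thm. 3.14 p. 738 and Prop. 5.2 p. 750,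
through which the proof of Thm. 5.7 (p. 755: "Combined with Proposition 5.2 and Lemma 5.4 (2) …")
goes, all print it — = the typed `Γ(n)Γ(n+1)`, `n = m + 1` (E-G131-1b). The named fact of §3
is a consequence of EITHER version: its constant `C` is ∃-quantified with the single property
`‖ι⁻¹ C‖_p = 1` (read (W3) with `C(π, λ) := 1` for the print); `φ(𝔉⁻¹) = φ(𝔉)⁻¹` in place of `φ(ℭ)`
only flips the exponent of an avatar value at a FIXED element of `Γ⁻`, which (W2)–(W3) absorb into
the ∃-quantified `Q` by a group-ring unit `[g]^{∓1}`; and (E2)'s factor is `1` on the typed range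
whether read at `𝔭̄` (e-print reading) or at `𝔭` (print: `𝔓̄` for `𝔓 ∈ Σ_p`), since `χ` is unramified
at every finite place there and `−2δ` is a unit at both primes above `p`. The e-print's sentence after
Thm. 2 on split conductor ("`𝔠_λ⁻ = (1)` ⇒ `μ⁻ = 0` always") is absent in print, and print's Thm. B (3)
reads "`p ∤ ∏_{v(𝔠_λ⁻)=1} ♯(Δ_{λ,v})`" (places exactly dividing `𝔠_λ⁻`) — neither is used in this module.

## What is typed (`𝓕 = ℚ`, `κ = 2`, `n := m + 1 ≥ 1`), and why each clause follows from the page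

SPECIALISATIONS of the hypotheses (each only shrinks the printed generality):
* (S1) `𝓕 = ℚ`, `𝓚 = K` imaginary quadratic (`IsImaginaryQuadratic K`); `σ₀ := w.embedding`,
  Mathlib's embedding of the unique infinite place `w` of `K`, through which the tree reads
  infinity types (`HasInfinityType p q`: `χ((x,1)) = σ₀(x)^{−p} \overline{σ₀(x)}^{−q}`) and the
  compatibility clause `k ∈ 𝔭 ↔ ‖ι⁻¹(σ₀(k))‖ < 1` of `castella2018_exists_isBDPLFunction` ("`𝔭`
  induced by `ι`"), repeated here verbatim;
* (S2) **CM type `Σ := {σ̄₀}`** (`σ̄₀ = conj ∘ σ₀ = σ₀ ∘ c_K`; `p`-ordinary iff `p` splits — Thm. 1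
  holds for EVERY `p`-ordinary CM type): then `Σ_p = {𝔭̄}` (`𝔭̄ = c_K 𝔭`, the prime induced by
  `ι⁻¹ ∘ σ̄₀`), the place `w̄` of the Coates multiplier is `𝔭` ITSELF, and Hsieh's `Σ`-infinity type
  `(k₁, k₂)` (`χ_∞(x) = σ̄₀(x)^{k₁} σ₀(x)^{k₂}`) is the tree's `HasInfinityType (fun _ ↦ −k₂) (fun _ ↦
  −k₁)`; in particular the interpolated characters of `Σ`-type `(n, −n)` are EXACTLY those of
  `IsBDPLFunction` (`HasInfinityType (n) (−n)`), and `λ` (`Σ`-type `(1, −1)`) has tree type `(1, −1)`;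
* (S3) `π = π_f`, `f ∈ S_2(Γ₀(N))` a NEWFORM (`IsNewform0 f`): trivial central character `ω = 1`,
  `κ = 2`; hence `λ|_{𝔸_ℚ^×} = 1` (typed through `AdeleRing.ideleBaseChange ℚ K`);
* (S4) `𝔫⁻ = 1`: EVERY `ℓ ∣ N` SPLITS in `K` (`SatisfiesHeegnerHypothesis N K`), so Hypothesis 1 and
  (sf) quantify over NO place and are vacuous (their root numbers are therefore not typed); `p ∣ N`
  allowed;
* (S5) `v_p(N) ≤ 1` (`¬ p² ∣ N`), used only in (E1);
* (S6) `λ` unramified OUTSIDE `p` — ramification AT `p` is allowed, as printed (`𝔑` is the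
  prime-to-`p` conductor; Thm. 1 carries no condition on `𝔠_λ`, condition (3) of Thm. 2 [p. 4 l. 33] is
  not a hypothesis here); then `𝔑 = N₀𝒪_K`, `N₀ = N/p^{v_p N}` (every `ℓ ∣ N` splits and the twist by
  the unramified `λ_ℓ` keeps `cond(π_ℓ)`), `𝔑⁻ = 1`, and a decomposition "`𝔑⁺ = ℭℭ̄`, `(ℭ, ℭ̄) = 1`"
  EXISTS by (S4) (`ℭ = ∏_{ℓ^e ‖ N₀} 𝔩_ℓ^e` for a choice of `𝔩_ℓ ∣ ℓ`); `ℭ` is then eliminated by (W3);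
* (S7) `λ̂ ∈ 𝔛`: `λ` is given WITH a `p`-adic avatar `r_λ` (geometric normalisation,
  `IsPAdicAvatarOf ι λ r_λ`, as Hsieh's `rec_𝓚`) factoring through `Γ⁻` (`FactorsThroughZp κ r_λ`,
  `κ` THE anticyclotomic `ℤ_p`-extension since `[𝓕:ℚ] = 1`) — a restriction on `λ`; such a `λ`
  EXISTS (twist any anticyclotomic character of `Σ`-type `(1, −1)` by a finite-order character of
  `p`-power conductor killing the torsion of `Gal(K⁻_{p^∞}/K)`) and is NECESSARILY RAMIFIED at both
  primes above `p` (`Γ⁻` is torsion-free), so the binder of (S6) must not be "simplified" to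
  "`λ` unramified everywhere" — Hsieh's `𝔛` contains `λ̂` of every `Σ`-weight `(m, −m)` [p. 3 ll. 28–32];
* (S8) the interpolation range is cut down to `φ̂ ∈ 𝔛` with `χ := λφ` UNRAMIFIED at every finite
  place, and is INDEXED BY `χ` (`Σ`-type `(n, −n)`, `n = m + 1 ≥ 1`, avatar `r_χ = r_λ r_φ` through
  `Γ⁻` — conversely every unramified `χ` of type `(n, −n)` with avatar through `Γ⁻` is `λφ` with
  `φ̂ = r_χ r_λ⁻¹ ∈ 𝔛` of weight `(n−1, 1−n)` by Hsieh's dictionary); on this range `L(½, π_𝓚 ⊗ χ) =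
  rankinSelbergValueHecke f χ 1` (unitary vs arithmetic normalisation; every Euler factor honest
  because every `ℓ ∣ N` splits and `χ` is unramified); NB the typed range is NOT all `n ≥ 1`: an
  everywhere-unramified `χ` of type `(n, −n)` has avatar `u ↦ u^{∓n}` on all of `𝒪_𝔭^× ⊇ μ_{p−1}`, so
  `FactorsThroughZp κ r` (`Γ⁻` pro-`p`) forces `(p − 1) ∣ n` — at `p = 3` the EVEN `n` —, still
  infinitely many interpolation points accumulating at `T = 0`; this is also the range of the tree's
  `IsBDPLFunction` (same binders), cf. Castella 2018, p. 9 ll. 23–27 ("`φ̂ : Γ → ℂ_p^×`, `φ` unramified");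
  the auxiliary `λ` of (S7) is correspondingly TAMELY RAMIFIED at `p` (`𝔭`-component `ω⁻¹`), as
  Hsieh's `𝔑` (prime-to-`p` conductor) allows.
WEAKENINGS of the conclusion (each implied by the printed one):
* (W1) receptacle `Λ = Z̄_p⟦Γ⁻⟧ ⊆ 𝒪_{ℂ_p}⟦Γ⁻⟧ ≅ 𝒪_{ℂ_p}⟦T⟧` (`γ ↦ 1 + T`, `γ` a topological generator
  of `Γ⁻ ≅ ℤ_p`; `𝒪_{ℂ_p} = PadicComplexInt p`), values at characters through `IntSeries.HasValueAt`
  (a `HasSum` in `ℂ_p`, same currency as `UnrSeries.HasValueAt`);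
* (W2) THE TWISTED VARIABLE: the typed element is `Q := [g]⁻¹ · Tw_{λ̂⁻¹}(𝒫_Σ(π,λ)²) ∈ Λ`, where
  `Tw_{λ̂⁻¹} : Λ → Λ`, `γ ↦ λ̂(γ)⁻¹γ` is the ring automorphism available because `λ̂` is a character
  of `Γ⁻` (S7) — `χ̂(Tw_{λ̂⁻¹}𝒫²) = (χ̂λ̂⁻¹)(𝒫²) = φ̂(𝒫²)`, so `Q` is evaluated at `χ̂ = λ̂φ̂`, i.e. at
  `T = r_χ(γ) − 1` (the move `L_p(f) := Tw_{ψ⁻¹}(ℒ_{𝔭,ψ}(f))` of Castella 2018, p. 9 ll. 41–47) —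
  and `[g] ∈ Γ⁻ ⊂ Λ^×` is ONE group element (W3); existence of `Q ∈ Λ` is immediate from that of `𝒫`;
* (W3) ABSORBED `φ`-INDEPENDENT FACTORS: by Hsieh's dictionary [p. 3 ll. 28–30] with `a` = the idèle
  of `ℭ` (trivial at `p`, `∞`), `φ(ℭ) = ι(φ̂(rec a_ℭ)) = ι(r_χ(σ_ℭ))·ι(r_λ(σ_ℭ))⁻¹`; with `a` = the
  idèle (`p` at `𝔭`, `1` elsewhere) and `χ` of weight `(n, −n)` unramified at `𝔭` (recall `𝔭 ∉ Σ_p`),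
  `χ_𝔭(p) = ι(r_χ(g_𝔭))·p^{n}`; so the two avatar values `r_χ(σ_ℭ)`, `r_χ(g_𝔭)` in the display are
  values at FIXED elements of `Γ⁻` and are removed by `[g]⁻¹`, `g := σ_ℭ·g_𝔭^{[p ∣ N]}`; the
  `φ`-INDEPENDENT constants are collected into ONE visible constant
  `C := [𝒪_K^×:ℤ^×]² · C(π,λ) · (−a_p)^{[p∣N]} · 4⁻¹ · ι(r_λ(σ_ℭ))⁻¹ ∈ ℂ`, ∃-quantified with its only
  printed property `‖ι⁻¹ C‖_p = 1` ([p. 4 l. 18]: `C(π,λ) ∈ Z̄_{(p)}^×` "explicit unit independent of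
  `φ`"; `[𝒪_K^×:ℤ^×] ∈ {1,2,3}` is prime to the odd `p` — for `p = 3`, `K ≠ ℚ(√−3)` as `3` splits —;
  `a_p = ±1` at `p ‖ N`; `4`; `r_λ(σ_ℭ)` a value of a continuous character; the quoted `C(π,λ)`
  sentence is the E-PRINT's — in PRINT the unit `C_π(λ)` is normalised into `ℒ_{Σ_p}(π, λ)` (proof of
  Thm. 5.7, p. 755) and Thm. A's display ends `[𝒪_𝓚^×:𝒪_𝓕^×]² · φ(𝔉⁻¹)`: the typed `C` is then the
  same product with `C(π,λ) := 1`, and `φ(𝔉⁻¹)` is absorbed by `[g]^{±1}` exactly as `φ(ℭ)` is — the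
  typed consequence is implied by either version, ERRATUM E-G131-1); what REMAINS VISIBLE
  besides `C` is `Γ(n)Γ(n+1)`, Hsieh's archimedean denominator `(Im δ)^{2n}(4π)^{2n+1}` up to the `4⁻¹`
  put into `C` — i.e. `(Im δ)^{2n}·4^{2n}·π^{2n+1}` —, the `p`-power `p^{n}` of the Steinberg root
  number, the Euler factor, the `L`-value and the periods;
* (W4) periods and `δ` EXISTENTIALLY quantified (after all hypotheses, before `∀ χ`) keeping only
  printed constraints: `Ω_K ≠ 0`, `Ω_p ∈ Z̄_p^× ⊆ 𝒪_{ℂ_p}^×` as `‖Ω_p‖ = 1`, `A := Im σ̄₀(δ) =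
  −Im σ₀(δ) > 0` as `A : ℝ`, `0 < A` ("`Im σ(δ) > 0` for `σ ∈ Σ = {σ̄₀}`" [p. 4 l. 5]; such a `δ` —
  "`δ̄ = −δ`", "`𝔠(𝒪_K) = (2δ)𝒟_{K/ℚ}` prime to `p𝔑𝔑̄`" [p. 4 ll. 4–7] — EXISTS: `δ = c/(2√d_K)` with `c ∈ ℤ`
  prime to `pN` of the right sign, `𝔠 = (c)`, so its elimination is a consequence; the arithmetic of
  `δ` is used only in (E2); only `A^{2n}` enters; in print `(Ω_∞, Ω_p)` depend on `(K, Σ)` only — here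
  they are quantified per datum, which is weaker).
EVALUATIONS on the typed range (a printed SYMBOL replaced by its value; flagged for the dictionary
reviewer; lit2 L-K15 / lit1 L57 locate the local formulas):
* (E1) for `χ` unramified at `𝔭` (= Hsieh's `w̄`), `ψ_p` of conductor `ℤ_p`: `L(½, π_p ⊗ χ_𝔭)^{−2} =
  (1 − a_p p⁻¹ x + e_p x²)²`, `x = χ_𝔭(ϖ_𝔭)` (`heckeValueExtZero χ 𝔭`, = `valueAtUniformizer` for
  unramified `χ`), `e_p = p⁻¹` (`p ∤ N`) / `0` (`p ∣ N`) — LITERALLY the polynomial of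
  `bdpInterpolationValue` —; `ε(½, π_p ⊗ χ_𝔭, ψ_p) = 1` if `p ∤ N` (unramified principal series), and
  `= −a_p·x = −a_p p^{n}·ι(r_χ(g_𝔭))` if `p ‖ N` (`π_p = μ St`, `μ(p) = a_p = ±1`; `ε(s, νSt, ψ) =
  −ν(ϖ)q^{1/2−s}` for unramified `ν`: Bump 1997, (5.52)–(5.53) [held: book p. 337 l. 32–p. 338
  l. 2] citing Jacquet–Langlands 1970, Prop. 3.6, and Prop. 3.1.9 [p. 264] for `ε = 1` at unramified
  data; R. Schmidt 2002, Table "`ε(½, μSt) = −μ(ϖ)`"; lit2 L-K15; explicitly, for the special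
  representation `σ(μ₁, μ₂)`, `μ₁μ₂⁻¹ = |·|`: `L(s, σ ⊗ ν) = L(s, νμ₁)` — also Hsieh §1.3, p. 7 ll. 38–52
  — and `ε(s, σ ⊗ ν, ψ) = ε(s, νμ₁, ψ)ε(s, νμ₂, ψ)·L(1−s, ν⁻¹μ₁⁻¹)/L(s, νμ₂)`, whence at `s = ½` with
  `μ₁ = μ|·|^{1/2}` unramified: `ε = (1 − μν(ϖ))/(1 − μν(ϖ)⁻¹) = −μν(ϖ)`) — sign and avatar value
  absorbed (W3), `p^{n}` kept (and since `A` is existentially quantified, even the sign of the exponent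
  of `p^{±n}` is immaterial to the TRUTH of the typed statement: `p^{−n}/A^{2n} = p^{n}/(pA)^{2n}`);
  Hsieh prints the symbol `E_{Σ_p}`, not this value (lit1 L56 H-9; r1/r2: a monomial, OUTCOME A);
* (E2) `ω⁻¹χ_w^{−2}(−2δ) = 1` for `w = 𝔭̄ ∈ Σ_p` on the typed range: `ω = 1`, `χ_𝔭̄` trivial on
  `𝒪_𝔭̄^×`, and `−2δ ∈ 𝒪_𝔭̄^×` (`p` odd, `p ∤ d_K` as `p` splits, `𝔠(𝒪_K) = 2δ√d_K·𝒪_K` prime to `p`);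
  the PRINT writes the multiplier as "(0.2) `e_{Σ_p}(π, χ)`" with last factor `χ_𝔓̄⁻²(−2δ)`,
  `𝔓 ∈ Σ_p` (p. 711), i.e. read at `𝔭` rather than `𝔭̄` — on the typed range the factor is `1` at
  EITHER prime above `p` (`χ` unramified at every finite place; `−2δ` a unit at both), so (E2) holds
  for both readings (ERRATUM E-G131-1).
NOT typed, NOT asserted: `Q ∈ R₀⟦T⟧` and `Ω_p ∈ R₀^×` (`R₀ = 𝒪(ℚ̂_p^ur)`: Hsieh's proof works over
`𝓦 = W(𝔽̄_p)[λ]` [p. 21 l. 30, p. 25 l. 7] with `λ` ramified at `p` in general and Gauss sums in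
`C(π,λ)`; printed as a statement only by Castella–Hsieh 2018, Def. 3.5 under `p ∤ N` and by
Castella 2018, Thm. 3.1 for `p ≥ 5`) — the consumer's residual. The typed `Ω_K, Ω_p, Q` are NOT the
printed canonical objects (`Ω_K^{typed} = Ω_K^{print}`·(absorbed real monomial)^{1/4}, `Q = unit ·
[g]⁻¹ · Tw(𝒫²)`): harmless for consumers of the ideal `(Q)` and of `ord_p Q(𝟙)`, but nobody may read
the typed periods as those of Hida–Tilouine (r2 D3EPS §3, caveat of record).

## References

* [Hsieh2014] M.-L. Hsieh, *Special values of anticyclotomic Rankin–Selberg L-functions*, Doc.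
  Math. 19 (2014) 709–767 (arXiv:1112.1580): Thm. 1 (pp. 3–4) = Thm. 5.6 (p. 23) of the e-print =
  Thm. A (p. 712) = Thm. 5.7 (p. 754) in print, Thm. 2 = Thm. B (p. 713) = Thm. 6.2 (p. 757),
  Hypothesis 1 = Hypothesis A (p. 710), (0.2) `e_{Σ_p}` (p. 711) — ERRATUM E-G131-1; p. 7 (`Z̄_p`);
  §3.6.2 (split places, p. 11); Prop. 3.5 (p. 12); (4.x) Coates multiplier (p. 17).
* [Bump1997] D. Bump, *Automorphic forms and representations*, CUP 1997, (5.52)–(5.53) (p. 337,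
  citing Jacquet–Langlands 1970, Prop. 3.6: `ε` of special representations) and Prop. 3.1.9 (p. 264).
* [JacquetLanglands1970] H. Jacquet, R. P. Langlands, *Automorphic forms on GL(2)*, LNM 114, Prop. 3.6.
* [Schmidt2002] R. Schmidt, *Some remarks on local newforms for GL(2)*, J. Ramanujan Math. Soc. 17
  (2002) 115–147, Table of local factors.
* [Castella2018] F. Castella, Camb. J. Math. 6 (2018), Thm. 3.1 and p. 9 (`Tw_{ψ⁻¹}`; the tree frame).
* [CastellaHsieh2018] F. Castella, M.-L. Hsieh, Math. Ann. 370 (2018), §3.3, Def. 3.5, Prop. 3.6.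
-/

noncomputable section

open scoped MatrixGroups ModularForm Topology NumberField
open CongruenceSubgroup NumberField IsDedekindDomain Field Polynomial
open Literature.NumberTheory.GaloisRepresentations
open Literature.NumberTheory.EllipticCurves.ModularForms
open Literature.NumberTheory.Automorphic

namespace Literature.NumberTheory.EllipticCurves

universe u

/-! ### §1. Values of an `𝒪_{ℂ_p}⟦T⟧`-valued element at points of the open unit disc -/

section IntSeries

variable {p : ℕ} [Fact p.Prime]

/-- **The value of `Q ∈ 𝒪_{ℂ_p}⟦T⟧` at the point `T = x` of the open unit disc of `ℂ_p`**:
`∑_k [T^k]Q · x^k = v` (a `HasSum` in `ℂ_p`). For Hsieh's `Λ = Z̄_p⟦Γ⁻⟧ ⊆ 𝒪_{ℂ_p}⟦Γ⁻⟧ ≅ 𝒪_{ℂ_p}⟦T⟧`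
(`γ ↦ 1 + T`, `γ` a topological generator of `Γ⁻ ≅ ℤ_p`), "`χ̂(Q)`" for a continuous character
`χ̂ : Γ⁻ → ℂ_p^×` is the value at `x = χ̂(γ) − 1`. Same currency as `UnrSeries.HasValueAt` of the
companion file (coefficients there in `R₀ ⊆ 𝒪_{ℂ_p}`).
[cite: Hsieh2014, Thm. A p. 712 (Doc. Math. 19) = Thm. 1 (arXiv:1112.1580 p. 4)] -/
def IntSeries.HasValueAt (Q : PowerSeries (PadicComplexInt p)) (x v : ℂ_[p]) : Prop :=
  HasSum (fun k : ℕ ↦ ((PowerSeries.coeff k Q : PadicComplexInt p) : ℂ_[p]) * x ^ k) v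

/-- The value at a point is unique (a `HasSum` limit in the Hausdorff space `ℂ_p`).
[cite: Hsieh2014, Thm. A p. 712 (Doc. Math. 19) = Thm. 1 (arXiv:1112.1580 p. 4)] -/
theorem IntSeries.HasValueAt.unique {Q : PowerSeries (PadicComplexInt p)} {x v v' : ℂ_[p]}
    (h : IntSeries.HasValueAt Q x v) (h' : IntSeries.HasValueAt Q x v') : v = v' :=
  HasSum.unique h h'

/-- An `R₀⟦T⟧`-valued element read coefficientwise in `𝒪_{ℂ_p}⟦T⟧ ⊇ R₀⟦T⟧` has the same values:
`IntSeries.HasValueAt Q x v ↔ UnrSeries.HasValueAt L x v` whenever the coefficients of `Q` and `L`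
agree in `ℂ_p` (the two receptacles `Z̄_p⟦Γ⁻⟧ ⊇ Λ_{R₀}` differ only by the coefficient ring; values
at `γ ↦ 1 + T` as in Castella 2018, §2.2). [cite: Castella2018, §2.2 (arXiv:1704.06608 p. 5)] -/
theorem IntSeries.hasValueAt_iff_of_coeff_eq {Q : PowerSeries (PadicComplexInt p)} {L : UnrSeries p}
    (h : ∀ k : ℕ, ((PowerSeries.coeff k Q : PadicComplexInt p) : ℂ_[p]) =
      ((PowerSeries.coeff k L : unrIntegers p) : ℂ_[p])) (x v : ℂ_[p]) :
    IntSeries.HasValueAt Q x v ↔ L.HasValueAt x v := by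
  unfold IntSeries.HasValueAt UnrSeries.HasValueAt
  simp_rw [h]

/-- **`R₀ ⊆ 𝒪_{ℂ_p}`**: Castella's `R₀ = unrIntegers p` (the closure in `ℂ_p` of the subring generated by
the roots of unity of order prime to `p`, companion file) lies in the valuation ring `𝒪_{ℂ_p}` (roots
of unity have valuation `1`; the valuation ring is a closed subring). So an `R₀⟦T⟧`-valued element IS an
`𝒪_{ℂ_p}⟦T⟧`-valued one (`hasValueAt_iff_of_coeff_eq`), and the consumer's residual "`Q` has
coefficients in `R₀`" is a genuine sharpening of the receptacle typed here.
[cite: Castella2018, §3 (arXiv:1704.06608 p. 9)] -/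
theorem unrIntegers_le_padicComplexInt :
    (unrIntegers p : Subring ℂ_[p]) ≤ (PadicComplexInt p).toSubring := by
  rw [unrIntegers]
  refine Subring.topologicalClosure_minimal _ (Subring.closure_le.mpr ?_) ?_
  · rintro ζ ⟨m, hm, -, hζ⟩
    change ζ ∈ PadicComplexInt p
    rw [PadicComplexInt, Valuation.mem_valuationSubring_iff]
    have hv : (Valued.v ζ) ^ m = 1 := by rw [← map_pow, hζ, map_one]
    exact ((pow_eq_one_iff_of_nonneg zero_le hm.ne').mp hv).le
  · exact Valued.isClosed_valuationSubring ℂ_[p]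

end IntSeries

/-! ### §2. Hsieh's interpolation value at `𝓕 = ℚ`, `κ = 2`, CM type `{σ̄₀}`, twisted variable -/

section Interpolation

variable {K : Type u} [Field K] [NumberField K] {N : ℕ}

/-- **The complex part of Hsieh's interpolation value** (Thm. 1 at `𝓕 = ℚ`, `κ = 2`, `Σ = {σ̄₀}`,
weight `(m, −m)`, `n = m + 1`, for `χ = λφ` unramified at the finite places; module docstring
(S2), (W3), (E1), (E2)), the two fixed avatar values having been absorbed into the element and the
`φ`-independent constants collected into `C`:

  `Γ(n)Γ(n+1) · p^{n·[p ∣ N]} · (1 − a_p p⁻¹ x + e_p x²)² · L(½, π_K ⊗ χ) · C / (A^{2n} · 4^{2n} ·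
   π^{2n+1} · Ω_K^{4n})`

with `A = Im σ̄₀(δ)`, `x = χ_𝔭(ϖ_𝔭)` (`heckeValueExtZero χ 𝔭`; `𝔭 = w̄` for `w = 𝔭̄ ∈ Σ_p`), `e_p = p⁻¹`
if `p ∤ N` and `0` if `p ∣ N` — from Hsieh's `E_{Σ_p}(π, χ) = ε(½, π_p ⊗ χ_𝔭, ψ_p) · L(½, π_p ⊗
χ_𝔭)^{−2} · ω⁻¹χ_𝔭̄^{−2}(−2δ) = (−a_p χ_𝔭(p))^{[p∣N]} · (1 − a_p p⁻¹ x + e_p x²)² · 1` with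
`χ_𝔭(p) = p^{n} ι(r_χ(g_𝔭))` (E1, E2): `p^{n·[p∣N]}` kept, `−a_p` in `C`, `r_χ(g_𝔭)` translated away —,
`L(½, π_K ⊗ χ) = rankinSelbergValueHecke f χ 1`, `C = [𝒪_K^×:ℤ^×]²·C(π,λ)·(−a_p)^{[p∣N]}·4⁻¹·
ι(r_λ(σ_ℭ))⁻¹`; it is `C · p^{n[p∣N]}/(A^{2n} 4^{2n})` times `bdpInterpolationValue p f 𝔭 χ n Ω_K`
(`hsiehInterpolationValue_eq_mul_bdpInterpolationValue`). A plain definition.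
[cite: Hsieh2014, Thm. A p. 712 (Doc. Math. 19) = Thm. 1 (arXiv:1112.1580 p. 4 ll. 9–18)] -/
def hsiehInterpolationValue (p : ℕ) (f : CuspForm (Gamma0 N) 2) (𝔭 : HeightOneSpectrum (𝓞 K))
    (χ : HeckeCharacter K) (n : ℕ) (A : ℝ) (ΩK C : ℂ) : ℂ :=
  let x : ℂ := heckeValueExtZero χ 𝔭
  let ep : ℂ := if p ∣ N then 0 else ((p : ℂ))⁻¹
  let ρp : ℂ := if p ∣ N then (p : ℂ) ^ n else 1
  Complex.Gamma n * Complex.Gamma (n + 1) * ρp *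
      (1 - cuspCoeff f p * ((p : ℂ))⁻¹ * x + ep * x ^ 2) ^ 2 * rankinSelbergValueHecke f χ 1 * C /
    ((A : ℂ) ^ (2 * n) * (4 : ℂ) ^ (2 * n) * (Real.pi : ℂ) ^ (2 * n + 1) * ΩK ^ (4 * n))

/-- **Hsieh's display is Castella's display times the printed archimedean ratio and the `p`-power
of the Steinberg root number and the constant**: `hsiehInterpolationValue = (C · p^{n[p∣N]} /
(A^{2n}·4^{2n})) · bdpInterpolationValue` (same `Γ(n)Γ(n+1)`, same Euler polynomial, same `L`-value,
same `Ω_K^{4n}`; the monomial `(p^{[p∣N]}/(16A²))^{n}` is what the consumer absorbs into the complex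
period, `C` into the element).
[cite: Hsieh2014, Thm. A p. 712 (Doc. Math. 19) = Thm. 1 (arXiv:1112.1580 p. 4)]
[cite: Castella2018, Thm. 3.1 (arXiv:1704.06608 p. 9)] -/
theorem hsiehInterpolationValue_eq_mul_bdpInterpolationValue (p : ℕ) (f : CuspForm (Gamma0 N) 2)
    (𝔭 : HeightOneSpectrum (𝓞 K)) (χ : HeckeCharacter K) (n : ℕ) (A : ℝ) (ΩK C : ℂ) :
    hsiehInterpolationValue p f 𝔭 χ n A ΩK C =
      C * (if p ∣ N then (p : ℂ) ^ n else 1) / ((A : ℂ) ^ (2 * n) * (4 : ℂ) ^ (2 * n)) *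
        bdpInterpolationValue p f 𝔭 χ n ΩK := by
  unfold hsiehInterpolationValue bdpInterpolationValue
  simp only
  split_ifs <;> ring

variable {p : ℕ} [Fact p.Prime]

/-- **Hsieh's interpolation property in the twisted variable** (Thm. 1 at `𝓕 = ℚ`, `κ = 2`, CM type
`{σ̄₀}`; module docstring (S2), (S7), (S8), (W1)–(W4)): `Q ∈ 𝒪_{ℂ_p}⟦T⟧` (`1 + T ↔ γ`, `γ` a
topological generator of the anticyclotomic `ℤ_p`-extension `κ : Γ_K ↠ ℤ_p` = Hsieh's `Γ⁻`)
satisfies: for every Hecke character `χ` of `K` UNRAMIFIED at all finite places, of `Σ`-infinity type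
`(n, −n)` with `n > 0` (tree `HasInfinityType (n) (−n)` — the type of `IsBDPLFunction`), and every
`p`-adic avatar `r` of `χ` (`IsPAdicAvatarOf ι χ r`, geometric Frobenius normalisation = Hsieh's
`rec_𝓚`) factoring through `Γ⁻` (`FactorsThroughZp κ r`), the value of `Q` at `T = r(γ) − 1` is
`ι⁻¹(hsiehInterpolationValue p f 𝔭 χ n A Ω_K C) · Ω_p^{4n}` (`2(κ+2m) = 4n`). Parameters: the
embedding datum `ι` (Hsieh's `ι` restricted to `ℚ̄_p`), the prime `𝔭` INDUCED by `ι` (= Hsieh's `w̄`,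
`w ∈ Σ_p`), `κ`, `γ`, the newform `f`, `A = Im σ̄₀(δ)`, `Ω_K`, the `φ`-independent constant `C`, `Ω_p`.
Same binder shape as `IsBDPLFunction` with the
receptacle widened to `𝒪_{ℂ_p}⟦T⟧` and Hsieh's constants in the display. A characterising
PREDICATE (plain definition; nothing asserted).
[cite: Hsieh2014, Thm. A p. 712 (Doc. Math. 19) = Thm. 1 (arXiv:1112.1580 p. 4 ll. 13–18)] -/
def IsHsiehLFunction (ι : PadicAlgCl p ≃+* ℂ) (𝔭 : HeightOneSpectrum (𝓞 K)) (κ : ZpExtension K p)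
    (γ : absoluteGaloisGroup K) (f : CuspForm (Gamma0 N) 2) (A : ℝ) (ΩK C : ℂ) (Ωp : ℂ_[p])
    (Q : PowerSeries (PadicComplexInt p)) : Prop :=
  ∀ (χ : HeckeCharacter K) (n : ℕ), 0 < n → (∀ v : HeightOneSpectrum (𝓞 K), χ.IsUnramifiedAt v) →
    χ.HasInfinityType (fun _ ↦ (n : ℤ)) (fun _ ↦ -(n : ℤ)) →
    ∀ r : FramedGaloisRep K (PadicAlgCl p) 1, IsPAdicAvatarOf ι χ r → FactorsThroughZp κ r →
      IntSeries.HasValueAt Q (avatarValueAt r γ - 1)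
        (((ι.symm (hsiehInterpolationValue p f 𝔭 χ n A ΩK C) : PadicAlgCl p) : ℂ_[p]) * Ωp ^ (4 * n))

/-- **Hsieh 2014, Theorem 1 (= Thm. 5.6) of the e-print = Theorem A (p. 712) = Thm. 5.7 (p. 754) of
Doc. Math. 19 (module docstring, ERRATUM E-G131-1): existence of the anticyclotomic Rankin–Selberg `p`-adic
`L`-function `𝒫_Σ(π, λ)² ∈ Λ = Z̄_p⟦Γ⁻⟧` with its interpolation formula** — named fact at `𝓕 = ℚ`,
`κ = 2`, CM type `Σ = {σ̄₀}`, typed in the twisted variable `χ = λφ` as a CONSEQUENCE of the printed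
statement by (S1)–(S8), (W1)–(W4), (E1)–(E2) of the module docstring. Hypotheses, as printed and
specialised: `p` ODD [p. 3 l. 24]; `π = π_f`, `f ∈ S_2(Γ₀(N))` a newform (`ω = 1`, weight `2`)
[p. 3 l. 4, l. 20]; `v_p(N) ≤ 1` (S5); `K` imaginary quadratic; (ord) ⟺ `p` SPLITS in `K` [p. 3
ll. 26–28]; `𝔭 ∋ p` the prime INDUCED by `ι` (compatibility clause verbatim as in
`castella2018_exists_isBDPLFunction`; Hsieh's `Σ_p = {𝔭̄}`); Hypothesis 1 [p. 3 l. 22] and (sf)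
[p. 4 l. 13] VACUOUS since every prime of `N` splits in `K` (S4); `λ` a unitary Hecke character of
`Σ`-infinity type `(κ/2, −κ/2) = (1, −1)` [p. 3 ll. 4–5, l. 20] (tree type `(1, −1)`) with
`λ|_{𝔸_ℚ^×} = ω⁻¹ = 1`, unramified outside `p` (S6), given with an avatar `r_λ` through `Γ⁻` (S7);
`κ` THE anticyclotomic `ℤ_p`-extension with topological generator `γ`. Conclusion (∃ AFTER all
hypotheses): there are `A = Im σ̄₀(δ) > 0`, `Ω_K ≠ 0`, the `φ`-independent constant `C` with
`‖ι⁻¹ C‖_p = 1` ([p. 4 l. 18] of the e-print with (W3); in print `C(π,λ) := 1`, ERRATUM E-G131-1), `Ω_p`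
with `‖Ω_p‖ = 1` and `Q = [g]⁻¹·Tw_{λ̂⁻¹}(𝒫_Σ(π_f, λ)²)
∈ 𝒪_{ℂ_p}⟦T⟧` with `IsHsiehLFunction ι 𝔭 κ γ f A Ω_K C Ω_p Q`. SCOPE: NOT the tree-frame statement
`∃ L : UnrSeries p, IsBDPLFunction …` — the `R₀`-rationality of (the re-normalised) `Q` and `Ω_p ∈
R₀^×` are the consumer's named residual (`Three.HsiehFrameResidualAt₃`; printed for `p ≥ 5` only,
Castella 2018 Thm. 3.1); the display differs from `bdpInterpolationValue` by `C` and the real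
monomial `(p^{[p∣N]}/(16 (Im δ)²))^{n}` (`hsiehInterpolationValue_eq_mul_bdpInterpolationValue`). The
typed `λ|_{𝔸_ℚ^×} = 1` binder is printed [p. 3 ll. 4–5] (lit1: automatic from type `(1,−1)` and
`λ̂` through `Γ⁻`; kept verbatim, harmless). At `p = 3 ‖ N` this is the only printed Λ-INTEGRAL
(measure) construction of the BDP-type element (lit1 L54: CH18 §3.3 / Cas18 §3.3 need `p ∤ N` /
`p ≥ 5`; Liu–Zhang–Zhang 2018, Thm. 3.8 gives the distribution at any `p` — lit2 L-K §12).
[cite: Hsieh2014, Thm. A p. 712 (Doc. Math. 19) = Thm. 1 (arXiv:1112.1580 pp. 3–4) and Thm. 5.6 (p. 23)]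
[cite: Castella2018, p. 9 ll. 41–47 (the twist Tw)] [cite: Bump1997, (5.52)–(5.53) p. 337 and Prop. 3.1.9 p. 264] -/
def hsieh2014_exists_anticyclotomicPAdicLFunction : Prop :=
  ∀ {p : ℕ} [Fact p.Prime] (ι : PadicAlgCl p ≃+* ℂ) (K : Type) [Field K] [NumberField K]
    (𝔭 : HeightOneSpectrum (𝓞 K)) (κ : ZpExtension K p) (γ : absoluteGaloisGroup K)
    {N : ℕ} [NeZero N] (f : CuspForm (Gamma0 N) 2) (lam : HeckeCharacter K)
    (rlam : FramedGaloisRep K (PadicAlgCl p) 1),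
    p ≠ 2 → IsNewform0 f → ¬ p ^ 2 ∣ N →
    IsImaginaryQuadratic K → ((Ideal.span {(p : ℤ)}).primesOver (𝓞 K)).ncard = 2 →
    ((p : ℕ) : 𝓞 K) ∈ 𝔭.asIdeal →
    (∀ (w : InfinitePlace K) (k : 𝓞 K), k ∈ 𝔭.asIdeal ↔ ‖ι.symm (w.embedding (k : K))‖ < 1) →
    SatisfiesHeegnerHypothesis N K →
    lam.IsUnitary → lam.HasInfinityType (fun _ ↦ (1 : ℤ)) (fun _ ↦ (-1 : ℤ)) →
    (∀ x : ideleGroup ℚ, lam (AdeleRing.ideleBaseChange ℚ K x) = 1) →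
    (∀ v : HeightOneSpectrum (𝓞 K), ((p : ℕ) : 𝓞 K) ∉ v.asIdeal → lam.IsUnramifiedAt v) →
    IsPAdicAvatarOf ι lam rlam → FactorsThroughZp κ rlam →
    κ.IsAnticyclotomic → κ.IsTopGenerator γ →
    ∃ (A : ℝ) (ΩK C : ℂ) (Ωp : ℂ_[p]) (Q : PowerSeries (PadicComplexInt p)),
      0 < A ∧ ΩK ≠ 0 ∧ ‖((ι.symm C : PadicAlgCl p) : ℂ_[p])‖ = 1 ∧ ‖Ωp‖ = 1 ∧
        IsHsiehLFunction ι 𝔭 κ γ f A ΩK C Ωp Q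

/-! #### API -/

variable {ι : PadicAlgCl p ≃+* ℂ} {𝔭 : HeightOneSpectrum (𝓞 K)} {κ : ZpExtension K p}
  {γ : absoluteGaloisGroup K} {f : CuspForm (Gamma0 N) 2} {A : ℝ} {ΩK C : ℂ} {Ωp : ℂ_[p]}
  {Q : PowerSeries (PadicComplexInt p)}

/-- Unfolding `IsHsiehLFunction` at one character of the typed range: the prescribed value of `Q` at
`T = χ̂(γ) − 1`. [cite: Hsieh2014, Thm. A p. 712 (Doc. Math. 19) = Thm. 1 (arXiv:1112.1580 p. 4)] -/
theorem IsHsiehLFunction.hasValueAt (hQ : IsHsiehLFunction ι 𝔭 κ γ f A ΩK C Ωp Q)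
    {χ : HeckeCharacter K} {n : ℕ} (hn : 0 < n)
    (hunr : ∀ v : HeightOneSpectrum (𝓞 K), χ.IsUnramifiedAt v)
    (hinf : χ.HasInfinityType (fun _ ↦ (n : ℤ)) (fun _ ↦ -(n : ℤ)))
    {r : FramedGaloisRep K (PadicAlgCl p) 1} (hr : IsPAdicAvatarOf ι χ r)
    (hκ : FactorsThroughZp κ r) :
    IntSeries.HasValueAt Q (avatarValueAt r γ - 1)
      (((ι.symm (hsiehInterpolationValue p f 𝔭 χ n A ΩK C) : PadicAlgCl p) : ℂ_[p]) * Ωp ^ (4 * n)) :=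
  hQ χ n hn hunr hinf r hr hκ

/-- The prescribed value at a character of the typed range is unique: any `v` with
`Q.HasValueAt (χ̂(γ) − 1) v` is Hsieh's right-hand side.
[cite: Hsieh2014, Thm. A p. 712 (Doc. Math. 19) = Thm. 1 (arXiv:1112.1580 p. 4)] -/
theorem IsHsiehLFunction.eq_of_hasValueAt (hQ : IsHsiehLFunction ι 𝔭 κ γ f A ΩK C Ωp Q)
    {χ : HeckeCharacter K} {n : ℕ} (hn : 0 < n)
    (hunr : ∀ v : HeightOneSpectrum (𝓞 K), χ.IsUnramifiedAt v)
    (hinf : χ.HasInfinityType (fun _ ↦ (n : ℤ)) (fun _ ↦ -(n : ℤ)))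
    {r : FramedGaloisRep K (PadicAlgCl p) 1} (hr : IsPAdicAvatarOf ι χ r)
    (hκ : FactorsThroughZp κ r) {v : ℂ_[p]} (hv : IntSeries.HasValueAt Q (avatarValueAt r γ - 1) v) :
    v = ((ι.symm (hsiehInterpolationValue p f 𝔭 χ n A ΩK C) : PadicAlgCl p) : ℂ_[p]) * Ωp ^ (4 * n) :=
  hv.unique (hQ.hasValueAt hn hunr hinf hr hκ)

omit [Fact p.Prime] in
/-- In the multiplicative case `p ∣ N` the term `e_p` vanishes and the Steinberg `p`-power appears:
`Γ(n)Γ(n+1) · p^{n} · (1 − a_p p⁻¹ x)² · L · C / (A^{2n} 4^{2n} π^{2n+1} Ω_K^{4n})`.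
[cite: Hsieh2014, Thm. A p. 712 (Doc. Math. 19) = Thm. 1 (arXiv:1112.1580 p. 4 ll. 9–11)] -/
theorem hsiehInterpolationValue_of_dvd (hpN : p ∣ N) (f : CuspForm (Gamma0 N) 2)
    (𝔭 : HeightOneSpectrum (𝓞 K)) (χ : HeckeCharacter K) (n : ℕ) (A : ℝ) (ΩK C : ℂ) :
    hsiehInterpolationValue p f 𝔭 χ n A ΩK C =
      Complex.Gamma n * Complex.Gamma (n + 1) * (p : ℂ) ^ n *
          (1 - cuspCoeff f p * ((p : ℂ))⁻¹ * heckeValueExtZero χ 𝔭) ^ 2 *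
          rankinSelbergValueHecke f χ 1 * C /
        ((A : ℂ) ^ (2 * n) * (4 : ℂ) ^ (2 * n) * (Real.pi : ℂ) ^ (2 * n + 1) * ΩK ^ (4 * n)) := by
  simp [hsiehInterpolationValue, hpN]

/-! #### The same theorem with the `p`-adic CM period in its printed home `𝒲 = R₀ = 𝒪(𝐐̂_p^ur)` -/

/-- **Hsieh 2014, Theorem 1 (= Thm. 5.6 of the e-print = Thm. A / Thm. 5.7 of Doc. Math. 19) WITH THE `p`-ADIC CM
PERIOD IN `𝒲^×`** — the named fact `hsieh2014_exists_anticyclotomicPAdicLFunction` VERBATIM (same hypotheses, same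
display `IsHsiehLFunction`, same `A = Im σ̄₀(δ) > 0`, `Ω_K ≠ 0`, `‖ι⁻¹C‖ = 1`), except that the `p`-adic period is
typed as a UNIT OF `R₀ = unrIntegers p` (the closure in `ℂ_p` of `ℤ_p[ζ : p ∤ ord ζ]`, i.e. the ring of integers `𝒲`
of the completion `𝐐̂_p^ur` of the maximal unramified extension) instead of an element of `ℂ_p` of norm one. SOURCE
OF THE SHARPENING: Hsieh's periods are, verbatim, «`(Ω_∞, Ω_p) ∈ (ℂ^×)^Σ × (Z̄_p^×)^Σ` the complex and CM periods of
`(𝒦, Σ)` introduced in [HT93] (`(Ω, c)` in [Katz78])» (arXiv:1112.1580 p. 23 l. 64, before Thm. 5.6; p. 4 l. 9 before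
Thm. 1), i.e. the Katz ∕ Hida–Tilouine CM periods, which for an imaginary quadratic `𝒦` with `p` split are DEFINED as a
pair «`(Ω_𝒦, Ω_p) ∈ ℂ^× × 𝒲^×`», «`𝒲` the ring of integers of `𝐐̂_p^ur`», by `Ω_𝒦 · 2πi dw = Ω_p · ω̂(η_{𝔞,p}) =
ω_{A_𝔞}` (Castella–Hsieh, Math. Ann. 370 (2018) §2.5, arXiv:1505.08165 p. 7 ll. 18–26 — the same author's statement of
the same periods; likewise Castella, Camb. J. Math. 6 (2018) Thm. 3.1: «`Ω_p ∈ R₀^×` and `Ω_K ∈ ℂ^×` are CM periods»,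
and de Shalit 1987 II.4.11 Remark (iii)); Hsieh's ambient «`Z̄_p^×`» (the `p`-adic completion of `Z̄`, p. 7 l. 36) is
the coarser ring in which he states all integrality, `𝒲 ⊂ Z̄_p`. So this `Prop` is the printed theorem with the
period read in the ring where the cited sources construct it; it IMPLIES `hsieh2014_exists_anticyclotomicPAdicLFunction`
(a unit of `R₀` has norm `1`; Summits-side `Theorems.hsieh2014_exists_anticyclotomicPAdicLFunction_of_unrPeriod`).
WHY IT MATTERS (consumer: crux `HsiehDescentAtThree` of routes `ClassRecordThree` ∕ `KolyvaginRoadThree` at `3 ∥ N`,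
`Summits/…/Theorems/ClassRecordThreeHsiehDescentUnramifiedPeriod*.lean`): with `Ω_p ∈ R₀` an inertial `τ̂` fixes
`Ω_p`, and the `R₀`-descent of Hsieh's element follows from value reciprocity by FINITENESS OF GALOIS ORBITS, without
the Tate–Sen theorem that the norm-one typing forces. A `Prop`, NOT asserted (named fact); nothing about the
`R₀`-rationality of `Q` itself is claimed (that stays the consumer's residual). -- TODO(general form): CM fields `𝒦/𝓕`,
general weight `κ` and CM type `Σ`, as in Hsieh's Thm. 1.
[cite: Hsieh2014, Thm. 1 (arXiv:1112.1580 pp. 3–4), Thm. 5.6 and p. 23 l. 64 (the periods of [HT93]/[Katz78])]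
[cite: CastellaHsieh2018, §2.5 (arXiv:1505.08165 p. 7 ll. 16–26) ((Ω_K, Ω_p) ∈ ℂ^× × 𝒲^×, 𝒲 = 𝒪(𝐐̂_p^ur))]
[cite: Castella2018, Thm. 3.1 (arXiv:1704.06608 p. 9) (Ω_p ∈ R₀^×)] -/
def hsieh2014_exists_anticyclotomicPAdicLFunction_unrPeriod : Prop :=
  ∀ {p : ℕ} [Fact p.Prime] (ι : PadicAlgCl p ≃+* ℂ) (K : Type) [Field K] [NumberField K]
    (𝔭 : HeightOneSpectrum (𝓞 K)) (κ : ZpExtension K p) (γ : absoluteGaloisGroup K)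
    {N : ℕ} [NeZero N] (f : CuspForm (Gamma0 N) 2) (lam : HeckeCharacter K)
    (rlam : FramedGaloisRep K (PadicAlgCl p) 1),
    p ≠ 2 → IsNewform0 f → ¬ p ^ 2 ∣ N →
    IsImaginaryQuadratic K → ((Ideal.span {(p : ℤ)}).primesOver (𝓞 K)).ncard = 2 →
    ((p : ℕ) : 𝓞 K) ∈ 𝔭.asIdeal →
    (∀ (w : InfinitePlace K) (k : 𝓞 K), k ∈ 𝔭.asIdeal ↔ ‖ι.symm (w.embedding (k : K))‖ < 1) →
    SatisfiesHeegnerHypothesis N K →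
    lam.IsUnitary → lam.HasInfinityType (fun _ ↦ (1 : ℤ)) (fun _ ↦ (-1 : ℤ)) →
    (∀ x : ideleGroup ℚ, lam (AdeleRing.ideleBaseChange ℚ K x) = 1) →
    (∀ v : HeightOneSpectrum (𝓞 K), ((p : ℕ) : 𝓞 K) ∉ v.asIdeal → lam.IsUnramifiedAt v) →
    IsPAdicAvatarOf ι lam rlam → FactorsThroughZp κ rlam →
    κ.IsAnticyclotomic → κ.IsTopGenerator γ →
    ∃ (A : ℝ) (ΩK C : ℂ) (Ωp : (unrIntegers p)ˣ) (Q : PowerSeries (PadicComplexInt p)),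
      0 < A ∧ ΩK ≠ 0 ∧ ‖((ι.symm C : PadicAlgCl p) : ℂ_[p])‖ = 1 ∧
        IsHsiehLFunction ι 𝔭 κ γ f A ΩK C ((Ωp : unrIntegers p) : ℂ_[p]) Q

end Interpolation

end Literature.NumberTheory.EllipticCurves

end
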